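import Summits.ResolutionOfSingularities.ResolutionOfSingularities.Theorems.EquisingularLiftDefs
import Mathlib.AlgebraicGeometry.Morphisms.ClosedImmersion
import HarnessLib

/-!
# [OURS · L1 W4.5(b) · EL♮] BAD-LOCUS PERSISTENCE: a point where `ϖ ∈ 𝔪²` stays bad under EVERY morphism over `Spec O`, and no
# section passes through it — seed of res-L1-w45b-strat-1's «Bad-locus persistence» programme (STRATEGY-CENSUS v6 §Negation), any scheme
# (crux `EquisingularLiftNat` = stmt-ResolutionOfSingularities-20038; K-∀n / disprover lane on piece A `stub_elnat_ge_four_reach`)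

HONEST FRAMING. OURS (cell res-hironaka, crux chain w45b, slot W4.5(b)); NOT a statement of any manuscript; replaces the role of
NOTHING in the manuscript; AI-written, AI review is weaker than expert review. Helper `--supports stmt-ResolutionOfSingularities-20038
--as helper`. The strategist's candidate invariant (v6 §Negation, «programme for res-D-brk-4 / lead-1's K-∀n lane, not a result»):
`Bad(X′) := {special points where ϖ ∈ 𝔪²}` — the complement of the good-reduction clause of `Split.GoodAt` (…EquisingularLiftDefs) —
only GROWS along a chain, and sections avoid it. This file proves the two elementary facts:

* `varpiGerm_mem_sq_of_over` — PERSISTENCE: for `f : P″ → P′` over `Spec O` and `y″ ↦ y′`, if the germ of `ϖ` at `y′` lies in `𝔪_{y′}²`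
  then its germ at `y″` lies in `𝔪_{y″}²` (the stalk map is a local homomorphism); hence `not_goodAt_of_bad_below`: every point over a bad
  point is bad (for ANY blow-up / morphism over `O`, centre through the point or not).
* `varpiGerm_not_mem_sq_of_section` — NO SECTION THROUGH A BAD POINT: if `s : Spec O → P′` is a section of `r′` and `ϖ ∉ 𝔪_O²`
  (e.g. `ϖ` a uniformiser of a DVR), then at `y = s(𝔪_O)` the germ of `ϖ` is not in `𝔪_y²`.

So the first touch at a bad non-regular point can only be a ramified multisection / a centre of positive relative dimension through it —
the typed constraint strat-1's programme starts from. References: `Split.GoodAt` (…EquisingularLiftDefs); Mathlib `Scheme.Hom.germ_stalkMap`.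
-/

set_option linter.dupNamespace false -- mandated namespace `Summit.<Summit>.<Problem>` of this single-conjunct summit

universe u

open CategoryTheory AlgebraicGeometry TopologicalSpace Topology IsLocalRing
open Summit.ResolutionOfSingularities.ResolutionOfSingularities.Theses.EquisingularLift.Split

namespace Summit.ResolutionOfSingularities.ResolutionOfSingularities.Cruxes.EquisingularLiftNat.Sections

/-! ## The germ of `ϖ` is natural -/

/-- Naturality of the germ of a base element: for `f : P″ → P′` with `f ≫ r′ = r″`, the germ of `ϖ` at `y″` (w.r.t. `r″`) is the image
under the stalk map `f_{y″}^♯` of the germ of `ϖ` at `f y″` (w.r.t. `r′`). [folklore] -/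
theorem varpiGerm_comp {O : Type} [CommRing O] {P' P'' : Scheme.{0}} (r' : P' ⟶ Spec (.of O)) (r'' : P'' ⟶ Spec (.of O))
    (f : P'' ⟶ P') (hf : f ≫ r' = r'') (y'' : P'') (ϖ : O) :
    (P''.presheaf.Γgerm y'').hom (r''.appTop.hom ((Scheme.ΓSpecIso (.of O)).inv.hom ϖ)) =
      (f.stalkMap y'').hom ((P'.presheaf.Γgerm (f y'')).hom (r'.appTop.hom ((Scheme.ΓSpecIso (.of O)).inv.hom ϖ))) := by
  subst hf
  change (P''.presheaf.germ ⊤ y'' trivial).hom ((r'.appTop ≫ f.appTop).hom ((Scheme.ΓSpecIso (.of O)).inv.hom ϖ)) =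
    (f.stalkMap y'').hom ((P'.presheaf.germ ⊤ (f y'') trivial).hom (r'.appTop.hom ((Scheme.ΓSpecIso (.of O)).inv.hom ϖ)))
  rw [Scheme.Hom.germ_stalkMap_apply]
  rfl

/-! ## PERSISTENCE: bad points stay bad above -/

/-- **BAD-LOCUS PERSISTENCE.** For `f : P″ → P′` over `Spec O` (`f ≫ r′ = r″`) and any `y″`: if the germ of `ϖ` at `f y″` lies in
`𝔪_{f y″}²`, then the germ of `ϖ` at `y″` lies in `𝔪_{y″}²` — the stalk map is a local homomorphism, so it maps `𝔪²` into `𝔪²`. In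
particular EVERY point over a bad point of a blow-up (centre through it or not) is bad. [folklore] -/
theorem varpiGerm_mem_sq_of_over {O : Type} [CommRing O] {P' P'' : Scheme.{0}} (r' : P' ⟶ Spec (.of O)) (r'' : P'' ⟶ Spec (.of O))
    (f : P'' ⟶ P') (hf : f ≫ r' = r'') (y'' : P'') (ϖ : O)
    (hbad : (P'.presheaf.Γgerm (f y'')).hom (r'.appTop.hom ((Scheme.ΓSpecIso (.of O)).inv.hom ϖ)) ∈
      (maximalIdeal (P'.presheaf.stalk (f y''))) ^ 2) :
    (P''.presheaf.Γgerm y'').hom (r''.appTop.hom ((Scheme.ΓSpecIso (.of O)).inv.hom ϖ)) ∈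
      (maximalIdeal (P''.presheaf.stalk y'')) ^ 2 := by
  rw [varpiGerm_comp r' r'' f hf y'' ϖ]
  have hloc : ((maximalIdeal (P'.presheaf.stalk (f y''))).map (f.stalkMap y'').hom) ≤ maximalIdeal (P''.presheaf.stalk y'') :=
    IsLocalRing.map_maximalIdeal_le (f.stalkMap y'').hom
  have h2 : ((maximalIdeal (P'.presheaf.stalk (f y''))) ^ 2).map (f.stalkMap y'').hom ≤ (maximalIdeal (P''.presheaf.stalk y'')) ^ 2 := by
    rw [Ideal.map_pow]
    exact Ideal.pow_right_mono hloc 2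
  exact h2 (Ideal.mem_map_of_mem _ hbad)

/-- **Every point over a bad point is bad**, in the `Split.GoodAt` currency: if `ϖ` is irreducible and its germ at `f y″` lies in `𝔪²`,
then `¬ GoodAt r″ y″`. [folklore] -/
theorem not_goodAt_of_bad_below {O : Type} [CommRing O] {P' P'' : Scheme.{0}} (r' : P' ⟶ Spec (.of O)) (r'' : P'' ⟶ Spec (.of O))
    (f : P'' ⟶ P') (hf : f ≫ r' = r'') (y'' : P'') (ϖ : O) (hϖ : Irreducible ϖ)
    (hbad : (P'.presheaf.Γgerm (f y'')).hom (r'.appTop.hom ((Scheme.ΓSpecIso (.of O)).inv.hom ϖ)) ∈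
      (maximalIdeal (P'.presheaf.stalk (f y''))) ^ 2) :
    ¬ GoodAt r'' y'' :=
  fun hg => hg.2 ϖ hϖ (varpiGerm_mem_sq_of_over r' r'' f hf y'' ϖ hbad)

/-- The bad locus is monotone along the item's chains: if `¬ GoodAt r′ (f y″)` because of the `ϖ`-clause — recorded as the
hypothesis that SOME irreducible `ϖ` has its germ in `𝔪²` at `f y″` — then `¬ GoodAt r″ y″`. [folklore] -/
theorem not_goodAt_of_exists_bad_below {O : Type} [CommRing O] {P' P'' : Scheme.{0}} (r' : P' ⟶ Spec (.of O))
    (r'' : P'' ⟶ Spec (.of O)) (f : P'' ⟶ P') (hf : f ≫ r' = r'') (y'' : P'')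
    (hbad : ∃ ϖ : O, Irreducible ϖ ∧ (P'.presheaf.Γgerm (f y'')).hom (r'.appTop.hom ((Scheme.ΓSpecIso (.of O)).inv.hom ϖ)) ∈
      (maximalIdeal (P'.presheaf.stalk (f y''))) ^ 2) :
    ¬ GoodAt r'' y'' := by
  obtain ⟨ϖ, hϖ, h⟩ := hbad
  exact not_goodAt_of_bad_below r' r'' f hf y'' ϖ hϖ h

/-! ## NO SECTION THROUGH A BAD POINT -/

/-- **Sections avoid bad points.** If `s : Spec O → P′` is a section of `r′ : P′ → Spec O` (`s ≫ r′ = 𝟙`) and `ϖ ∉ 𝔪_O²` at the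
closed point (`O` local; e.g. `ϖ` a uniformiser of a DVR), then the germ of `ϖ` at `y := s(𝔪_O)` is NOT in `𝔪_y²`: apply the local
homomorphism `s_y^♯ : 𝒪_{P′,y} → 𝒪_{Spec O, 𝔪}` and naturality (`varpiGerm_comp` for `s ≫ r′ = 𝟙`). [folklore] -/
theorem varpiGerm_not_mem_sq_of_section {O : Type} [CommRing O] [IsLocalRing O] {P' : Scheme.{0}} (r' : P' ⟶ Spec (.of O))
    (s : Spec (.of O) ⟶ P') (hs : s ≫ r' = 𝟙 _) (ϖ : O)
    (hϖ : ((Spec (.of O)).presheaf.Γgerm (IsLocalRing.closedPoint O)).hom ((Scheme.ΓSpecIso (.of O)).inv.hom ϖ) ∉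
      (maximalIdeal ((Spec (.of O)).presheaf.stalk (IsLocalRing.closedPoint O))) ^ 2) :
    (P'.presheaf.Γgerm (s (IsLocalRing.closedPoint O))).hom (r'.appTop.hom ((Scheme.ΓSpecIso (.of O)).inv.hom ϖ)) ∉
      (maximalIdeal (P'.presheaf.stalk (s (IsLocalRing.closedPoint O)))) ^ 2 := by
  intro hbad
  apply hϖ
  have h := varpiGerm_mem_sq_of_over r' (𝟙 _) s hs (IsLocalRing.closedPoint O) ϖ hbad
  simpa using h

end Summit.ResolutionOfSingularities.ResolutionOfSingularities.Cruxes.EquisingularLiftNat.Sections
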